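import Summits.Ventures.PackingBounds.Configurations.DesignIdentities
import Summits.Ventures.PackingBounds.Configurations.GramIsometry
import Literature.Geometry.DiscreteGeometry.ThreePointKernelGeneral

/-!
# Node-set rigidity of the diplo-simplex: `2n + 2` unit vectors of `ℝⁿ` with inner products in `{-1, ±1/n}`

Framing: lottery ticket; floor = certified bounds/negative ranges. Venture `PackingBounds` (cell `pub-packcert`,
seat `pub-packcert-energy`, gen 25) — the UNIQUENESS RIDER of the diplo-simplex family of sharp three-point energy
bounds (cell STRUCTURE.md §3, P-E5/P-E6), every dimension `n ≥ 3` at once.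
**Theorem (`exists_simplex_half`, `isometric_of_nodesets`).** If `X ⊂ S^{n-1}`, `|X| = 2n + 2`, has all pairwise
inner products in `{-1, -1/n, 1/n}`, then `X = Y ∪ (-Y)` for a regular simplex `Y`; any two such `X` are isometric.
Proof: degree-2 Gegenbauer positivity (`BachocVallentin.pairSum_gegenbauer_nonneg`) forces every point to have its
antipode in `X` and then the moment vanishes; strength-2 polarisation (`DesignIdentities.sum_inner_mul_inner`) gives
`Σ_{w ∈ X} ⟪u,w⟫⟪v,w⟫ = ((2n+2)/n) ⟪u,v⟫`; with `u = x₀` and `N = {w : ⟪x₀,w⟫ = -1/n}`: `Σ_{w ∈ N} ⟪v,w⟫ = -⟪v,x₀⟫`,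
which forces all inner products inside `{x₀} ∪ N` to be `-1/n`. Use: a SHARP three-point certificate with Hermite
node set `{-1, ±1/n}` puts every minimiser's inner products in the node set (cell file DIPLO-UNIQUENESS-g25.md).

## References
* P. Delsarte, J.-M. Goethals, J. J. Seidel, Geom. Dedicata 6 (1977) 363–388, §§4–5. [`DelsarteGoethalsSeidel1977`]
* B. Ballinger et al., Experiment. Math. 18 (2009) 257–283, §3.4 (the diplo-simplex). [`BallingerEtAl2009`]
-/

noncomputable section

open Finset Literature.Analysis.SpecialFunctions Literature.Geometry.DiscreteGeometry
open scoped RealInnerProductSpace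

namespace Summit.Ventures.PackingBounds.Config.DiploSimplexUnique

variable {n : ℕ}

/-- Unit vectors with inner product `-1` are antipodal. -/
private theorem eq_neg_of_inner_eq_neg_one {x y : EuclideanSpace ℝ (Fin n)} (hx : ‖x‖ = 1) (hy : ‖y‖ = 1)
    (h : inner ℝ x y = -1) : y = -x := by
  have h0 : ‖x + y‖ ^ 2 = 0 := by
    rw [← real_inner_self_eq_norm_sq, inner_add_left, inner_add_right, inner_add_right,
      real_inner_self_eq_norm_sq, real_inner_self_eq_norm_sq, hx, hy, real_inner_comm x y, h]
    norm_num
  exact (neg_eq_of_add_eq_zero_right (norm_eq_zero.mp (pow_eq_zero_iff two_ne_zero |>.mp h0))).symm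

/-- A unit vector is not its own antipode. -/
private theorem neg_ne_self {x : EuclideanSpace ℝ (Fin n)} (hx : ‖x‖ = 1) : -x ≠ x := fun h => by
  have h2 : (2 : ℝ) • x = 0 := by rw [two_smul]; nth_rw 1 [← h]; simp
  have : x = 0 := (smul_eq_zero.mp h2).resolve_left two_ne_zero
  exact zero_ne_one (by rw [this, norm_zero] at hx; exact hx)

/-- `C₂^{(μ)}(t) = 2μ(μ+1) t² - μ`. -/
private theorem gegenbauerSum_two_eval (μ t : ℝ) : gegenbauerSum μ 2 t = 2 * μ * (μ + 1) * t ^ 2 - μ := by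
  simp [gegenbauerSum, gegenbauerCoeff, Finset.sum_range_succ, Finset.prod_range_succ, Nat.factorial]
  ring

section main

variable (hn : 3 ≤ n) (X : Finset (EuclideanSpace ℝ (Fin n))) (h1 : ∀ x ∈ X, ‖x‖ = 1)
  (hcard : X.card = 2 * n + 2)
  (hZ : ∀ x ∈ X, ∀ y ∈ X, x ≠ y → inner ℝ x y = -1 ∨ inner ℝ x y = -1 / (n : ℝ) ∨ inner ℝ x y = 1 / (n : ℝ))
include h1 hZ

/-- Off the antipode, squared inner products are `1/n²`. -/
theorem inner_sq_eq {x y : EuclideanSpace ℝ (Fin n)} (hx : x ∈ X) (hy : y ∈ X) (hxy : x ≠ y) (hyx : y ≠ -x) :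
    inner ℝ x y ^ 2 = 1 / (n : ℝ) ^ 2 := by
  rcases hZ x hx y hy hxy with h | h | h
  · exact absurd (eq_neg_of_inner_eq_neg_one (h1 x hx) (h1 y hy) h) hyx
  · rw [h]; ring
  · rw [h]; ring

/-- Row sums of squared inner products: `Σ_{y ∈ X} ⟪x,y⟫² = 1 + (|X|-1)/n² + (1 - 1/n²)·[−x ∈ X]`. -/
theorem row_sq_sum {x : EuclideanSpace ℝ (Fin n)} (hx : x ∈ X) :
    ∑ y ∈ X, inner ℝ x y ^ 2 =
      1 + ((X.card : ℝ) - 1) / (n : ℝ) ^ 2 + (if -x ∈ X then 1 - 1 / (n : ℝ) ^ 2 else 0) := by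
  classical
  rw [← add_sum_erase X _ hx, real_inner_self_eq_norm_sq, h1 x hx]
  have hterm : ∀ y ∈ X.erase x, inner ℝ x y ^ 2 = 1 / (n : ℝ) ^ 2 + if -x = y then 1 - 1 / (n : ℝ) ^ 2 else 0 := by
    intro y hy
    have hyX := mem_of_mem_erase hy
    have hyx := ne_of_mem_erase hy
    by_cases h : -x = y
    · rw [if_pos h, ← h, inner_neg_right, real_inner_self_eq_norm_sq, h1 x hx]; ring
    · rw [if_neg h, inner_sq_eq X h1 hZ hx hyX hyx.symm (fun e => h e.symm)]; ring
  rw [sum_congr rfl hterm, sum_add_distrib, sum_const, card_erase_of_mem hx, sum_ite_eq]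
  have hne : -x ≠ x := neg_ne_self (h1 x hx)
  have hmem : (-x ∈ X.erase x) ↔ -x ∈ X := by
    rw [mem_erase]; exact ⟨fun h => h.2, fun h => ⟨hne, h⟩⟩
  have hc : ((X.card - 1 : ℕ) : ℝ) = (X.card : ℝ) - 1 := by
    have : 1 ≤ X.card := card_pos.mpr ⟨x, hx⟩
    push_cast [Nat.cast_sub this]; ring
  simp only [nsmul_eq_mul, hc, hmem]
  split_ifs <;> ring

include hn hcard

/-- **Step 1: `X` is antipodal.** -/
theorem neg_mem {x : EuclideanSpace ℝ (Fin n)} (hx : x ∈ X) : -x ∈ X := by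
  classical
  by_contra hneg
  set μ : ℝ := ((n : ℝ) - 2) / 2 with hμ
  have hn3 : (3 : ℝ) ≤ n := by exact_mod_cast hn
  have hμpos : 0 < μ := by rw [hμ]; linarith
  have hnpos : (0 : ℝ) < n := by linarith
  -- positivity of the total degree-2 moment
  have hpos := BachocVallentin.pairSum_gegenbauer_nonneg hn 2 X h1
  unfold BachocVallentin.pairSum at hpos
  simp only [gegenbauerSum_two_eval] at hpos
  -- Σ_{x,y} (2μ(μ+1) t² - μ) = 2μ(μ+1) S - μ |X|²
  have hS : ∑ a ∈ X, ∑ b ∈ X, (2 * μ * (μ + 1) * inner ℝ a b ^ 2 - μ) =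
      2 * μ * (μ + 1) * (∑ a ∈ X, ∑ b ∈ X, inner ℝ a b ^ 2) - μ * (X.card : ℝ) ^ 2 := by
    simp only [sum_sub_distrib, sum_const, nsmul_eq_mul, mul_sum]
    ring
  rw [hS] at hpos
  -- row bounds
  have hrow_le : ∀ a ∈ X, ∑ b ∈ X, inner ℝ a b ^ 2 ≤ 2 + ((X.card : ℝ) - 2) / (n : ℝ) ^ 2 := by
    intro a ha
    rw [row_sq_sum X h1 hZ ha]
    have hn2 : (0 : ℝ) < (n : ℝ) ^ 2 := by positivity
    have hkey : ((X.card : ℝ) - 1) / (n : ℝ) ^ 2 = ((X.card : ℝ) - 2) / (n : ℝ) ^ 2 + 1 / (n : ℝ) ^ 2 := by ring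
    have h1n : 1 / (n : ℝ) ^ 2 ≤ 1 := by rw [div_le_one hn2]; nlinarith
    split_ifs <;> linarith
  have hrow_x : ∑ b ∈ X, inner ℝ x b ^ 2 = 1 + ((X.card : ℝ) - 1) / (n : ℝ) ^ 2 := by
    rw [row_sq_sum X h1 hZ hx, if_neg hneg, add_zero]
  have hSle : ∑ a ∈ X, ∑ b ∈ X, inner ℝ a b ^ 2 ≤
      ((X.card : ℝ) - 1) * (2 + ((X.card : ℝ) - 2) / (n : ℝ) ^ 2) + (1 + ((X.card : ℝ) - 1) / (n : ℝ) ^ 2) := by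
    rw [← add_sum_erase X _ hx, hrow_x]
    have h2 : ∑ a ∈ X.erase x, ∑ b ∈ X, inner ℝ a b ^ 2 ≤ ∑ a ∈ X.erase x, (2 + ((X.card : ℝ) - 2) / (n : ℝ) ^ 2) :=
      sum_le_sum fun a ha => hrow_le a (mem_of_mem_erase ha)
    rw [sum_const, card_erase_of_mem hx, nsmul_eq_mul] at h2
    have hc : ((X.card - 1 : ℕ) : ℝ) = (X.card : ℝ) - 1 := by
      have : 1 ≤ X.card := card_pos.mpr ⟨x, hx⟩
      push_cast [Nat.cast_sub this]; ring
    rw [hc] at h2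
    linarith
  have hX : (X.card : ℝ) = 2 * n + 2 := by exact_mod_cast hcard
  rw [hX] at hSle hpos
  -- contradiction: 2μ(μ+1) S - μ(2n+2)² < 0
  have hn0 : (n : ℝ) ≠ 0 := hnpos.ne'
  have h2μ : 2 * μ * (μ + 1) = μ * n := by rw [hμ]; ring
  have hSup : (n : ℝ) * (((2 * n + 2 : ℝ) - 1) * (2 + ((2 * n + 2 : ℝ) - 2) / (n : ℝ) ^ 2) +
      (1 + ((2 * n + 2 : ℝ) - 1) / (n : ℝ) ^ 2)) = (2 * n + 2 : ℝ) ^ 2 - ((n : ℝ) ^ 2 - 1) / n := by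
    field_simp
    ring
  have hpos2 : 0 < μ * (((n : ℝ) ^ 2 - 1) / n) := mul_pos hμpos (div_pos (by nlinarith) hnpos)
  have key : 2 * μ * (μ + 1) * (((2 * n + 2 : ℝ) - 1) * (2 + ((2 * n + 2 : ℝ) - 2) / (n : ℝ) ^ 2) +
      (1 + ((2 * n + 2 : ℝ) - 1) / (n : ℝ) ^ 2)) - μ * (2 * n + 2 : ℝ) ^ 2 < 0 := by
    rw [h2μ, mul_assoc, hSup]
    have : μ * ((2 * n + 2 : ℝ) ^ 2 - ((n : ℝ) ^ 2 - 1) / n) - μ * (2 * n + 2 : ℝ) ^ 2 =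
        -(μ * (((n : ℝ) ^ 2 - 1) / n)) := by ring
    linarith
  have hmono : 2 * μ * (μ + 1) * (∑ a ∈ X, ∑ b ∈ X, inner ℝ a b ^ 2) ≤
      2 * μ * (μ + 1) * (((2 * n + 2 : ℝ) - 1) * (2 + ((2 * n + 2 : ℝ) - 2) / (n : ℝ) ^ 2) +
      (1 + ((2 * n + 2 : ℝ) - 1) / (n : ℝ) ^ 2)) :=
    mul_le_mul_of_nonneg_left hSle (by positivity)
  linarith

/-- **Step 2: the total degree-2 moment vanishes** (`X` is a spherical 2-design). -/
theorem total_moment_two_eq_zero :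
    ∑ x ∈ X, ∑ y ∈ X, gegenbauerSum (((n : ℝ) - 2) / 2) 2 (inner ℝ x y) = 0 := by
  classical
  simp only [gegenbauerSum_two_eval]
  have hrow : ∀ a ∈ X, ∑ b ∈ X, inner ℝ a b ^ 2 = 2 + ((X.card : ℝ) - 2) / (n : ℝ) ^ 2 := by
    intro a ha
    rw [row_sq_sum X h1 hZ ha, if_pos (neg_mem hn X h1 hcard hZ ha)]
    ring
  have hS : ∑ a ∈ X, ∑ b ∈ X, (2 * (((n : ℝ) - 2) / 2) * (((n : ℝ) - 2) / 2 + 1) * inner ℝ a b ^ 2 - ((n : ℝ) - 2) / 2) =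
      ∑ a ∈ X, (2 * (((n : ℝ) - 2) / 2) * (((n : ℝ) - 2) / 2 + 1) * (2 + ((X.card : ℝ) - 2) / (n : ℝ) ^ 2) -
        ((n : ℝ) - 2) / 2 * (X.card : ℝ)) := by
    refine sum_congr rfl fun a ha => ?_
    rw [sum_sub_distrib, sum_const, nsmul_eq_mul, ← mul_sum, hrow a ha]
    ring
  rw [hS, sum_const, nsmul_eq_mul]
  have hX : (X.card : ℝ) = 2 * n + 2 := by exact_mod_cast hcard
  rw [hX]
  have hn0 : (n : ℝ) ≠ 0 := by
    have : (3 : ℝ) ≤ n := by exact_mod_cast hn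
    linarith
  field_simp
  ring

/-- **Step 3: the tight-frame identity** `Σ_{w ∈ X} ⟪u,w⟫ ⟪v,w⟫ = ((2n+2)/n) ⟪u,v⟫`. -/
theorem frame_identity (u v : EuclideanSpace ℝ (Fin n)) :
    ∑ w ∈ X, inner ℝ u w * inner ℝ v w = (2 * n + 2 : ℝ) / n * inner ℝ u v := by
  have hn3 : (3 : ℝ) ≤ n := by exact_mod_cast hn
  have h := DesignIdentities.sum_inner_mul_inner (n := n) (μ := ((n : ℝ) - 2) / 2) (by ring) (by linarith) X h1
    (total_moment_two_eq_zero hn X h1 hcard hZ) u v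
  rw [h]
  congr 1
  rw [show (X.card : ℝ) = 2 * n + 2 by exact_mod_cast hcard]

/-- **Step 4: the simplex half.** For `x₀ ∈ X` let `N = {w ∈ X : ⟪x₀,w⟫ = -1/n}`; then `|N| = n` and all inner
products inside `{x₀} ∪ N` are `-1/n`, and `X = Y ∪ (-Y)` for `Y = {x₀} ∪ N`. -/
theorem exists_simplex_half : ∃ Y : Finset (EuclideanSpace ℝ (Fin n)), Y ⊆ X ∧ Y.card = n + 1 ∧
    (∀ y ∈ Y, ∀ y' ∈ Y, y ≠ y' → inner ℝ y y' = -1 / (n : ℝ)) ∧ X = Y ∪ Y.image (fun y => -y) := by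
  classical
  have hn3 : (3 : ℝ) ≤ n := by exact_mod_cast hn
  have hnpos : (0 : ℝ) < n := by linarith
  have hn0 : (n : ℝ) ≠ 0 := hnpos.ne'
  have hpm : (1 : ℝ) / n ≠ -1 / n := by
    intro h; field_simp at h; linarith
  obtain ⟨x0, hx0⟩ : X.Nonempty := by rw [← card_pos, hcard]; omega
  have hnx0 : -x0 ∈ X := neg_mem hn X h1 hcard hZ hx0
  have hne0 : -x0 ≠ x0 := neg_ne_self (h1 x0 hx0)
  -- the rest R = X \ {x0, -x0} and its two halves
  set R := (X.erase x0).erase (-x0) with hR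
  set N := R.filter (fun w => inner ℝ x0 w = -1 / (n : ℝ)) with hN
  set P := R.filter (fun w => ¬ inner ℝ x0 w = -1 / (n : ℝ)) with hP
  have hRX : ∀ w ∈ R, w ∈ X := fun w hw => mem_of_mem_erase (mem_of_mem_erase hw)
  have hRval : ∀ w ∈ R, inner ℝ x0 w = -1 / (n : ℝ) ∨ inner ℝ x0 w = 1 / (n : ℝ) := by
    intro w hw
    have hw1 : w ≠ -x0 := ne_of_mem_erase hw
    have hw2 : w ≠ x0 := ne_of_mem_erase (mem_of_mem_erase hw)
    rcases hZ x0 hx0 w (hRX w hw) hw2.symm with h | h | h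
    · exact absurd (eq_neg_of_inner_eq_neg_one (h1 x0 hx0) (h1 w (hRX w hw)) h) hw1
    exacts [Or.inl h, Or.inr h]
  have hPval : ∀ w ∈ P, inner ℝ x0 w = 1 / (n : ℝ) := by
    intro w hw
    rw [hP, mem_filter] at hw
    exact (hRval w hw.1).resolve_left hw.2
  have hNval : ∀ w ∈ N, inner ℝ x0 w = -1 / (n : ℝ) := fun w hw => (mem_filter.mp hw).2
  have hNX : ∀ w ∈ N, w ∈ X := fun w hw => hRX w (mem_filter.mp hw).1
  -- splitting sums over X
  have hsplit : ∀ f : EuclideanSpace ℝ (Fin n) → ℝ,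
      ∑ w ∈ X, f w = f x0 + f (-x0) + ∑ w ∈ N, f w + ∑ w ∈ P, f w := by
    intro f
    rw [← add_sum_erase X f hx0, ← add_sum_erase (X.erase x0) f (mem_erase.mpr ⟨hne0, hnx0⟩), ← hR,
      ← sum_filter_add_sum_filter_not R (fun w => inner ℝ x0 w = -1 / (n : ℝ)) f]
    ring
  -- P is the reflection of N
  have hPN : P = N.image (fun w => -w) := by
    ext w
    rw [mem_image]
    constructor
    · intro hw
      have hwR : w ∈ R := (mem_filter.mp hw).1
      refine ⟨-w, ?_, neg_neg w⟩
      rw [hN, mem_filter]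
      have hwX := hRX w hwR
      have hnw : -w ∈ X := neg_mem hn X h1 hcard hZ hwX
      refine ⟨?_, by rw [inner_neg_right, hPval w hw]; ring⟩
      rw [hR, mem_erase, mem_erase]
      refine ⟨fun h => ?_, fun h => ?_, hnw⟩
      · have : w = x0 := neg_injective h
        exact ne_of_mem_erase (mem_of_mem_erase hwR) this
      · have : w = -x0 := by rw [← h, neg_neg]
        exact ne_of_mem_erase hwR this
    · rintro ⟨u, hu, rfl⟩
      have huR : u ∈ R := (mem_filter.mp hu).1
      have huX := hRX u huR
      have hnu : -u ∈ X := neg_mem hn X h1 hcard hZ huX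
      rw [hP, mem_filter]
      refine ⟨?_, by rw [inner_neg_right, hNval u hu]; intro h; apply hpm; rw [← h]; ring⟩
      rw [hR, mem_erase, mem_erase]
      refine ⟨fun h => ?_, fun h => ?_, hnu⟩
      · have : u = x0 := neg_injective h
        exact ne_of_mem_erase (mem_of_mem_erase huR) this
      · have : u = -x0 := by rw [← h, neg_neg]
        exact ne_of_mem_erase huR this
  have hsumP : ∀ f : EuclideanSpace ℝ (Fin n) → ℝ, ∑ w ∈ P, f w = ∑ w ∈ N, f (-w) := by
    intro f
    rw [hPN, sum_image fun a _ b _ h => neg_injective h]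
  -- |N| = n from the frame identity at u = v = x0
  have hcardN : (N.card : ℝ) = n := by
    have h := frame_identity hn X h1 hcard hZ x0 x0
    rw [hsplit, hsumP] at h
    rw [real_inner_self_eq_norm_sq, h1 x0 hx0, inner_neg_right, real_inner_self_eq_norm_sq, h1 x0 hx0] at h
    have hNs : ∑ w ∈ N, inner ℝ x0 w * inner ℝ x0 w = ∑ w ∈ N, (1 / (n : ℝ) ^ 2) :=
      sum_congr rfl fun w hw => by rw [hNval w hw]; ring
    have hPs : ∑ w ∈ N, inner ℝ x0 (-w) * inner ℝ x0 (-w) = ∑ w ∈ N, (1 / (n : ℝ) ^ 2) :=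
      sum_congr rfl fun w hw => by rw [inner_neg_right, hNval w hw]; ring
    rw [hNs, hPs, sum_const, nsmul_eq_mul] at h
    field_simp at h
    nlinarith [h, hnpos]
  -- Σ_{w ∈ N} ⟪v, w⟫ = -⟪v, x0⟫ for every v
  have hsumN : ∀ v : EuclideanSpace ℝ (Fin n), ∑ w ∈ N, inner ℝ v w = -inner ℝ v x0 := by
    intro v
    have h := frame_identity hn X h1 hcard hZ x0 v
    rw [hsplit, hsumP] at h
    rw [real_inner_self_eq_norm_sq, h1 x0 hx0, inner_neg_right, inner_neg_right, real_inner_self_eq_norm_sq,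
      h1 x0 hx0] at h
    have hNs : ∑ w ∈ N, inner ℝ x0 w * inner ℝ v w = -1 / (n : ℝ) * ∑ w ∈ N, inner ℝ v w := by
      rw [mul_sum]; exact sum_congr rfl fun w hw => by rw [hNval w hw]
    have hPs : ∑ w ∈ N, inner ℝ x0 (-w) * inner ℝ v (-w) = -1 / (n : ℝ) * ∑ w ∈ N, inner ℝ v w := by
      rw [mul_sum]; exact sum_congr rfl fun w hw => by rw [inner_neg_right, inner_neg_right, hNval w hw]; ring
    rw [hNs, hPs, real_inner_comm x0 v] at h
    set T := ∑ w ∈ N, inner ℝ v w with hT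
    set I := inner ℝ x0 v with hI
    have h' : (2 : ℝ) / n * (T + I) = 0 := by
      have e1 : (1 : ℝ) ^ 2 * I + -(1 : ℝ) ^ 2 * -I + -1 / (n : ℝ) * T + -1 / (n : ℝ) * T =
          (2 * n + 2 : ℝ) / n * I - 2 / n * (T + I) := by
        field_simp
        ring
      rw [e1] at h
      linarith
    have h2 : (2 : ℝ) / n ≠ 0 := by positivity
    have := (mul_eq_zero.mp h').resolve_left h2
    rw [real_inner_comm x0 v]
    linarith [hI]
  -- all inner products inside N are -1/n
  have hNN : ∀ y ∈ N, ∀ w ∈ N, y ≠ w → inner ℝ y w = -1 / (n : ℝ) := by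
    intro y hy
    have hyX := hNX y hy
    -- lower bound termwise and the exact sum
    have hge : ∀ w ∈ N.erase y, -1 / (n : ℝ) ≤ inner ℝ y w := by
      intro w hw
      have hwN := mem_of_mem_erase hw
      have hwX := hNX w hwN
      rcases hZ y hyX w hwX (ne_of_mem_erase hw).symm with h | h | h
      · -- w = -y would put w in P, not N
        exfalso
        have hw' : w = -y := eq_neg_of_inner_eq_neg_one (h1 y hyX) (h1 w hwX) h
        have h2 := hNval w hwN
        rw [hw', inner_neg_right, hNval y hy] at h2
        apply hpm; linarith [h2, show (-1 : ℝ) / n = -(1 / n) by ring]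
      · exact h.ge
      · rw [h]
        have : (0 : ℝ) < 1 / n := by positivity
        have : -1 / (n : ℝ) = -(1 / n) := by ring
        linarith
    have hsum : ∑ w ∈ N.erase y, inner ℝ y w = ∑ w ∈ N.erase y, (-1 / (n : ℝ)) := by
      have htot := hsumN y
      rw [← add_sum_erase N _ hy, real_inner_self_eq_norm_sq, h1 y hyX, real_inner_comm, hNval y hy] at htot
      rw [sum_const, card_erase_of_mem hy, nsmul_eq_mul]
      have hc : ((N.card - 1 : ℕ) : ℝ) = (n : ℝ) - 1 := by
        have : 1 ≤ N.card := card_pos.mpr ⟨y, hy⟩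
        push_cast [Nat.cast_sub this]; rw [hcardN]
      rw [hc]
      field_simp
      field_simp at htot
      linarith
    have heach := (sum_eq_sum_iff_of_le fun w hw => hge w hw).mp hsum.symm
    intro w hw hyw
    exact (heach w (mem_erase.mpr ⟨fun h => hyw h.symm, hw⟩)).symm
  -- assemble Y = insert x0 N
  have hx0N : x0 ∉ N := by
    intro h
    have := hNval x0 h
    rw [real_inner_self_eq_norm_sq, h1 x0 hx0] at this
    have : (0 : ℝ) < 1 / n := by positivity
    have : -1 / (n : ℝ) = -(1 / n) := by ring
    linarith
  refine ⟨insert x0 N, ?_, ?_, ?_, ?_⟩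
  · intro y hy
    rcases mem_insert.mp hy with rfl | hy
    · exact hx0
    · exact hNX y hy
  · rw [card_insert_of_notMem hx0N]
    exact_mod_cast (show (N.card : ℝ) + 1 = n + 1 by rw [hcardN])
  · intro y hy y' hy' hyy'
    rcases mem_insert.mp hy with rfl | hyN <;> rcases mem_insert.mp hy' with rfl | hy'N
    · exact absurd rfl hyy'
    · exact hNval y' hy'N
    · rw [real_inner_comm]; exact hNval y hyN
    · exact hNN y hyN y' hy'N hyy'
  · ext w
    rw [mem_union, mem_image]
    constructor
    · intro hw
      by_cases h0 : w = x0
      · exact Or.inl (h0 ▸ mem_insert_self x0 N)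
      by_cases h0' : w = -x0
      · exact Or.inr ⟨x0, mem_insert_self x0 N, h0'.symm⟩
      have hwR : w ∈ R := by
        rw [hR, mem_erase, mem_erase]; exact ⟨h0', h0, hw⟩
      by_cases hv : inner ℝ x0 w = -1 / (n : ℝ)
      · exact Or.inl (mem_insert_of_mem (mem_filter.mpr ⟨hwR, hv⟩))
      · have hwP : w ∈ P := mem_filter.mpr ⟨hwR, hv⟩
        rw [hPN, mem_image] at hwP
        obtain ⟨u, hu, rfl⟩ := hwP
        exact Or.inr ⟨u, mem_insert_of_mem hu, rfl⟩
    · rintro (hw | ⟨u, hu, rfl⟩)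
      · rcases mem_insert.mp hw with rfl | hwN
        · exact hx0
        · exact hNX w hwN
      · rcases mem_insert.mp hu with rfl | huN
        · exact hnx0
        · exact neg_mem hn X h1 hcard hZ (hNX u huN)

end main

/-- **Uniqueness of the diplo-simplex as a node-set configuration (every `n ≥ 3`).** Any two `(2n+2)`-point
configurations of unit vectors of `ℝⁿ` whose pairwise inner products lie in `{-1, -1/n, 1/n}` are isometric.
[cite: BallingerEtAl2009, §3.4] -/
theorem isometric_of_nodesets (hn : 3 ≤ n) (X X' : Finset (EuclideanSpace ℝ (Fin n)))
    (h1 : ∀ x ∈ X, ‖x‖ = 1) (hcard : X.card = 2 * n + 2)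
    (hZ : ∀ x ∈ X, ∀ y ∈ X, x ≠ y → inner ℝ x y = -1 ∨ inner ℝ x y = -1 / (n : ℝ) ∨ inner ℝ x y = 1 / (n : ℝ))
    (h1' : ∀ x ∈ X', ‖x‖ = 1) (hcard' : X'.card = 2 * n + 2)
    (hZ' : ∀ x ∈ X', ∀ y ∈ X', x ≠ y → inner ℝ x y = -1 ∨ inner ℝ x y = -1 / (n : ℝ) ∨ inner ℝ x y = 1 / (n : ℝ)) :
    ∃ Ψ : EuclideanSpace ℝ (Fin n) ≃ₗᵢ[ℝ] EuclideanSpace ℝ (Fin n), X' = X.image Ψ := by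
  classical
  obtain ⟨Y, hYX, hYc, hYi, hXY⟩ := exists_simplex_half hn X h1 hcard hZ
  obtain ⟨Y', hYX', hYc', hYi', hXY'⟩ := exists_simplex_half hn X' h1' hcard' hZ'
  obtain ⟨Ψ, hΨ⟩ := isometric_of_inner_const Y Y' (-1 / (n : ℝ)) (fun y hy => h1 y (hYX hy)) hYi
    (fun y hy => h1' y (hYX' hy)) hYi' (by rw [hYc, hYc'])
  refine ⟨Ψ, ?_⟩
  rw [hXY', hXY, hΨ, image_union, image_image, image_image]
  congr 1
  refine image_congr fun y _ => ?_
  simp [Function.comp]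

end Summit.Ventures.PackingBounds.Config.DiploSimplexUnique
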